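import Summits.QuantumFields.YangMills.Theorems.UnitScaleTiltProp7CornerCombTiedSourceBoxes
import Summits.QuantumFields.YangMills.Theorems.UnitScaleTiltProp7CellBoxMultiplicity
import Summits.QuantumFields.YangMills.Theorems.UnitScaleTiltProp7CombPeriodCellDict
import HarnessLib

/-!
# (n3)-COMB (II), row `hMcomb₂`, located difficulty H2-1(E) — MEMBER FILE M-2 «Λ-PRICING»:
# the reading boxes of a TIED source READ PERIODICALLY, and the Λ-part of the `ℓ¹` propagation theorem summed over any finite centre set

Crux `stmt-QuantumFields-19200` `MinimiserStabilityRegPr`, route-R E′ (A′)-on-Σ, P-A2 (β); supplier design (II) (★routeR-w1 g9 MASTER §4: H2-1), px18 g4's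
LOCATE «H2-1(E) SUPPLIER — THE MEMBER KNIT SKELETON OVER THE LANDED ℓ¹ KIT» (19200 evidence 2686e4bb) §1 (1e)–(1f), §2 file M-2.  Width seat `ym3-torus-px13` (gen 7);
`--kind proof --supports stmt-QuantumFields-19200 --as helper`; THEOREMS ONLY (0 `def`, 0 `sorry`); «(O2) groundwork — not consumed by any displayed row before the freeze
lifts»; count-neutral.  YM₃ on T³ is a ladder rung (R3), not d = 4, not infinite volume, not a mass gap, not Clay; nothing here is progress on the YM mass gap.

## The point
✓`Prop7CornerCombTiedSourceBoxes.sum_norm_tied_box_le_localisedMass` prices ONE reading box `box q ρ` of a tied source `s` (`‖s y κ‖ ≤ C·M₂(y,κ)`, two-block `ℓ²`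
masses of `Ỹ`) by the mass and the norm-gap energy of `Ỹ` on a BIG CONCENTRIC box `box (L•q) R`.  Along the level-`l` cell the big boxes around consecutive corners overlap
with unbounded multiplicity (px18's located CAUTION (1f)), so the member must read `Ỹ` PERIODICALLY: for an `N`-periodic nonnegative `f` and ANY centre `q`,
`Σ_{x ∈ box q R} f x ≤ ⌈(2R+1)∕N⌉ᵈ · Σ_{one period cell} f` — ✓`Prop7CellBoxMultiplicity.sum_cell_sum_box_le` (F-6d-1) at `N′ := 1`, read at a CENTRED box of
[Balaban1984PropagatorsII]-style radius through lit `B4Eq19LatticeOperators.sum_box_add_right` and ✓`Prop7CombPeriodCellDict.sum_box_eq_sum_boxVec`.  With it the priced box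
becomes a bound by the PERIOD-CELL currencies `MASScell(Ỹ) := Σ_{y ∈ [0,N)ᵈ}Σ_ν‖Ỹ y ν‖²` and `NORMGAPcell(Ỹ) := Σ_{y ∈ [0,N)ᵈ}Σ_νΣ_μ(‖Ỹ(y+e_μ) ν‖ − ‖Ỹ y ν‖)²`,
UNIFORM IN THE CENTRE `q` — and the Λ-part of ✓`Prop7CornerCombL1PropagationBoxes.sum_norm_linTower_le_boxes` (its second summand, reading boxes `box (Lⁿ•z) ρᵢ`,
`box (Lⁿ•(z+e_κ)) ρᵢ`) sums over ANY finite centre set `Zk` to `2·d·#Zk` copies of the uniform bound, level by level.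

WHAT IS PROVED (ns `…Theorems.Prop7CornerCombH21ELambdaPricing`; all `theorem`s):
* §1 (any `d`, any additive target) `box_const_eq_box` (lit centred box of radius `R` about `R·𝟙` = the cornered box `[0,2R+1)ᵈ`), `sum_box_centred_eq_sum_boxVec`
  (a centred-box sum as a `Fin d → Fin (2R+1)` sum), ★ `sum_box_le_pow_mul_sum_cell_of_periodic` (THE PERIODIC COUNT FOR CENTRED BOXES: `Σ_{box q R} f ≤ Aᵈ·Σ_{cell} f`
  whenever `2R + 1 ≤ A·N`, `f ≥ 0` `N`-periodic; any centre).
* §2 (`d = 3` through ✓D) ★★ `sum_norm_tied_box_le_cell` — ✓D's priced reading box with the big box READ PERIODICALLY: for `L·ρ + 2L ≤ R`, `2R + 1 ≤ A·N`,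
  `Σ_{y∈box q ρ}Σ_κ‖s y κ‖ ≤ C·(2d·((1+t)·((2(Lρ+2L)+1)ᵈ∕(2R+1)ᵈ)·(Aᵈ·MASScell) + (1+t⁻¹)·13068·((Lρ+2L)+1)²·(Aᵈ·NORMGAPcell)))` — NO `q` ON THE RIGHT.
* §3 (any `d`) ★ `sum_lambdaPart_le_of_uniform` — the Λ-part of ✓C's conclusion over any finite `Zk`, given per-level bounds `B i` uniform in the centre:
  `Σ_{i<n}(Π_{m<i}w_m)·Σ_{z∈Zk}Σ_κ(Σ_{box (Lⁿ•z) ρᵢ}Σ_μ‖s‖ + Σ_{box (Lⁿ•(z+e_κ)) ρᵢ}Σ_μ‖s‖) ≤ Σ_{i<n}(Π_{m<i}w_m)·(2·d·#Zk·B i)`.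
* §4 (`d = 3`) ★★★ `sum_lambdaPart_tied_le_cell` — §3 ∘ §2 with per-level radii `ρ' i ≥ 0`, big radii `R i` (`L·ρ' i + 2L ≤ R i`) and counts `A i` (`2·R i + 1 ≤ A i·N`)
  left to the caller (M-3 chooses them: `R i + 1 ≈ N∕2` low, `R i := L·ρ' i + 2L` — volume fraction `1` — at the top).
DEPENDENCE: constants are ✓D's (`C`, `2d`, `(1+t)`, `13068`, radii) times the count `Aᵈ`; nothing reads `n`, the torus, `K`, the member beyond the displayed letters.
NOT HERE: the straight box (M-1), the `Σ_j` ∕ ✓p708988 products and the `hMcomb` ∕ (G_j) currencies (M-3), windows ∕ cells at `RegPr` (M-4).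
HONEST: finite-sum bookkeeping over landed rows; nothing of H2-1's member ∕ `hMcomb₂` ∕ `hMcomb` ∕ (β) ∕ the crux is proved or claimed; rung R3 (YM₃ on T³), NOT d = 4,
NOT infinite volume, NOT a mass gap, NOT Clay; YM gap NOT proved.
References: T. Bałaban, CMP 98 (1985) 17–51 [Balaban1985Averaging] ((2) p.17, (124)–(126) p.36); CMP 95 (1984) 17–40 [Balaban1984PropagatorsII] ((1.9) p.226);
CMP 109 (1987) 249–301 [Balaban1987RG1] ((0.1) p.251); M. Giaquinta, *Multiple integrals…* [Giaquinta1984] (Ch. III §1 pp.64–72).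
-/

set_option autoImplicit false

noncomputable section

open scoped BigOperators
open Finset

namespace Summit.QuantumFields.YangMills.Theorems.Prop7CornerCombH21ELambdaPricing

open Literature.MathematicalPhysics.QuantumFieldTheory.Balaban1983to89
open B7Prop1Explicit (Site e e_apply boxVec)
open B4Eq19LatticeOperators (box mem_box card_box sum_box_add_right)
open Summit.QuantumFields.YangMills.Theorems.Prop7CellBoxMultiplicity (sum_cell_sum_box_le sum_cell_shift_vec)
open Summit.QuantumFields.YangMills.Theorems.Prop7CombPeriodCellDict (sum_box_eq_sum_boxVec)
open Summit.QuantumFields.YangMills.Theorems.Prop7CornerCombTiedSourceBoxes (sum_norm_tied_box_le_localisedMass)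

/-! ## §1 The periodic count for centred boxes (any `d`) -/

section Count

variable {d : ℕ}

/-- The lit centred box of radius `R` about the point `R·𝟙` is the cornered box `[0, 2R+1)ᵈ` of `T4TermwiseTorus`. [folklore]
[cite: Giaquinta1984, Ch. III §1 p.64; Balaban1985Averaging, (2) p.17] -/
theorem box_const_eq_box (R : ℕ) :
    box (d := d) (fun _ => (R : ℤ)) (R : ℤ) = T4TermwiseTorus.box (d := d) (2 * R + 1) := by
  ext x
  rw [mem_box, T4TermwiseTorus.mem_box]
  refine forall_congr' fun κ => ?_
  rw [abs_le]
  push_cast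
  constructor
  · rintro ⟨h1, h2⟩; constructor <;> linarith
  · rintro ⟨h1, h2⟩; constructor <;> linarith

/-- **A CENTRED-BOX SUM AS A CORNERED-BOX SUM**: `Σ_{x ∈ box q R} f x = Σ_{u ∈ [0,2R+1)ᵈ} f (u + (q − R·𝟙))`. [folklore]
[cite: Giaquinta1984, Ch. III §1 p.64; Balaban1987RG1, (0.1) p.251] -/
theorem sum_box_centred_eq_sum_boxVec {M : Type*} [AddCommMonoid M] (q : Site d) (R : ℕ) (f : Site d → M) :
    ∑ x ∈ box q (R : ℤ), f x = ∑ u : Fin d → Fin (2 * R + 1), f (boxVec (2 * R + 1) u + (q - fun _ => (R : ℤ))) := by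
  have h := sum_box_add_right f (fun _ => (R : ℤ)) (q - fun _ => (R : ℤ)) (R : ℤ)
  rw [add_sub_cancel] at h
  rw [← h, box_const_eq_box, sum_box_eq_sum_boxVec]

/-- ★ **THE PERIODIC COUNT FOR CENTRED BOXES**: for `f ≥ 0` which is `N`-periodic in every coordinate direction and ANY centre `q ∈ ℤᵈ`, a centred box of radius `R` with
`2R + 1 ≤ A·N` reads at most `Aᵈ` period cells: `Σ_{x ∈ box q R} f x ≤ Aᵈ · Σ_{y ∈ [0,N)ᵈ} f y` (✓F-6d-1 `sum_cell_sum_box_le` at `N′ := 1`, the corner moved by ✓`sum_cell_shift_vec`).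
[cite: Balaban1985Averaging, (2) p.17, (125)–(126) p.36; Giaquinta1984, Ch. III §1 p.70] -/
theorem sum_box_le_pow_mul_sum_cell_of_periodic (N A : ℕ) [NeZero N] (f : Site d → ℝ) (hf : ∀ y, 0 ≤ f y)
    (hfp : ∀ (y : Site d) (κ : Fin d), f (y + (N : ℤ) • e κ) = f y) (q : Site d) (R : ℕ) (hA : 2 * R + 1 ≤ A * N) :
    ∑ x ∈ box q (R : ℤ), f x ≤ (A : ℝ) ^ d * ∑ y : Fin d → Fin N, f (boxVec N y) := by
  rw [sum_box_centred_eq_sum_boxVec]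
  set v : Site d := q - fun _ => (R : ℤ) with hv
  -- the shifted function is nonnegative and periodic
  have hg : ∀ y, 0 ≤ f (y + v) := fun y => hf _
  have hgp : ∀ (y : Site d) (κ : Fin d), f (y + (N : ℤ) • e κ + v) = f (y + v) := fun y κ => by
    rw [add_right_comm, hfp]
  have hN : 1 ≤ N := Nat.one_le_iff_ne_zero.mpr (NeZero.ne N)
  have h := sum_cell_sum_box_le (d := d) 1 N (2 * R + 1) A hN hA N (by rw [one_mul]) (fun y => f (y + v)) hg hgp
  -- the `Fin d → Fin 1` sum is a single term at the corner `0`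
  have h0 : ∀ z : Fin d → Fin 1, (N : ℤ) • boxVec (d := d) 1 z = 0 := fun z => by
    have hz : boxVec (d := d) 1 z = 0 := funext fun κ => by
      have : z κ = 0 := Subsingleton.elim _ _
      simp [boxVec, this]
    rw [hz, smul_zero]
  simp_rw [h0, zero_add] at h
  rw [Fintype.sum_unique (fun _ : Fin d → Fin 1 =>
    ∑ u : Fin d → Fin (2 * R + 1), f (boxVec (2 * R + 1) u + v))] at h
  -- move the corner back on the cell side
  rw [sum_cell_shift_vec N f hfp v] at h
  exact h

end Count

/-! ## §2 ✓D's priced reading box, read periodically (`d = 3`) -/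

section Priced

variable {d : ℕ} {𝔸 : Type*} [SeminormedAddCommGroup 𝔸] {𝔅 : Type*} [SeminormedAddCommGroup 𝔅]

/-- ★★ **THE PRICED READING BOX OF A TIED SOURCE, READ PERIODICALLY** (`d = 3`): ✓`sum_norm_tied_box_le_localisedMass` with its big concentric box `box (L•q) R` bounded by
`Aᵈ` period cells of the `N`-periodic field `Ỹ` (`2R + 1 ≤ A·N`; §1 applied to the mass density `Σ_ν‖Ỹ · ν‖²` and to the norm-gap density `Σ_νΣ_μ(‖Ỹ(·+e_μ) ν‖ − ‖Ỹ · ν‖)²`, both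
periodic and nonnegative; box cardinalities by lit `card_box`).  The right side does not read the centre `q`:
`Σ_{y∈box q ρ}Σ_κ‖s y κ‖ ≤ C·(2d·((1+t)·((2(Lρ+2L)+1)ᵈ∕(2R+1)ᵈ)·(Aᵈ·MASScell) + (1+t⁻¹)·13068·((Lρ+2L)+1)²·(Aᵈ·NORMGAPcell)))`.
«(O2) groundwork.» [cite: Balaban1985Averaging, (2) p.17, (124)–(126) p.36; Giaquinta1984, Ch. III §1 pp.64–72] -/
theorem sum_norm_tied_box_le_cell (hd : d = 3) (L : ℕ) (hL : 1 ≤ L) (s : Site d → Fin d → 𝔸) (Yt : Site d → Fin d → 𝔅)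
    {C : ℝ} (hC : 0 ≤ C)
    (hs : ∀ (y : Site d) (κ : Fin d), ‖s y κ‖ ≤ C * ∑ σ : Fin d → Fin L, ∑ ν : Fin d,
      (‖Yt ((L : ℤ) • y + boxVec L σ) ν‖ ^ 2 + ‖Yt ((L : ℤ) • y + (L : ℤ) • e κ + boxVec L σ) ν‖ ^ 2))
    (N A : ℕ) [NeZero N] (hper : ∀ (x : Site d) (κ : Fin d), Yt (x + (N : ℤ) • e κ) = Yt x)
    (q : Site d) {ρ : ℤ} (hρ : 0 ≤ ρ) (R : ℕ) (hR : (L : ℤ) * ρ + 2 * L ≤ (R : ℤ)) (hA : 2 * R + 1 ≤ A * N)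
    {t : ℝ} (ht : 0 < t) :
    ∑ y ∈ box q ρ, ∑ κ : Fin d, ‖s y κ‖ ≤
      C * (2 * d * ((1 + t) * ((((2 * ((L : ℤ) * ρ + 2 * L) + 1 : ℤ) : ℝ) ^ d) / (((2 * (R : ℤ) + 1 : ℤ) : ℝ) ^ d)) *
            ((A : ℝ) ^ d * ∑ y : Fin d → Fin N, ∑ ν : Fin d, ‖Yt (boxVec N y) ν‖ ^ 2) +
          (1 + 1 / t) * 13068 * ((((L : ℤ) * ρ + 2 * L : ℤ) : ℝ) + 1) ^ 2 *
            ((A : ℝ) ^ d * ∑ y : Fin d → Fin N, ∑ ν : Fin d, ∑ μ : Fin d, (‖Yt (boxVec N y + e μ) ν‖ - ‖Yt (boxVec N y) ν‖) ^ 2))) := by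
  -- ✓D: the priced box with the big concentric box `box (L•q) R`
  have h1 := sum_norm_tied_box_le_localisedMass hd L hL s Yt hC hs q hρ hR ht
  have hρ1 : (0 : ℤ) ≤ (L : ℤ) * ρ + 2 * L := by positivity
  have hR0 : (0 : ℤ) ≤ (R : ℤ) := by positivity
  rw [card_box _ hρ1, card_box _ hR0] at h1
  -- the two big-box currencies read periodically (§1)
  have hM : ∑ x ∈ box ((L : ℤ) • q) (R : ℤ), ∑ ν : Fin d, ‖Yt x ν‖ ^ 2
      ≤ (A : ℝ) ^ d * ∑ y : Fin d → Fin N, ∑ ν : Fin d, ‖Yt (boxVec N y) ν‖ ^ 2 :=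
    sum_box_le_pow_mul_sum_cell_of_periodic N A (fun x => ∑ ν : Fin d, ‖Yt x ν‖ ^ 2)
      (fun y => Finset.sum_nonneg fun ν _ => sq_nonneg _) (fun y κ => by simp_rw [hper y κ]) ((L : ℤ) • q) R hA
  have hG : ∑ x ∈ box ((L : ℤ) • q) (R : ℤ), ∑ ν : Fin d, ∑ μ : Fin d, (‖Yt (x + e μ) ν‖ - ‖Yt x ν‖) ^ 2
      ≤ (A : ℝ) ^ d * ∑ y : Fin d → Fin N, ∑ ν : Fin d, ∑ μ : Fin d, (‖Yt (boxVec N y + e μ) ν‖ - ‖Yt (boxVec N y) ν‖) ^ 2 :=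
    sum_box_le_pow_mul_sum_cell_of_periodic N A (fun x => ∑ ν : Fin d, ∑ μ : Fin d, (‖Yt (x + e μ) ν‖ - ‖Yt x ν‖) ^ 2)
      (fun y => Finset.sum_nonneg fun ν _ => Finset.sum_nonneg fun μ _ => sq_nonneg _)
      (fun y κ => by simp_rw [add_right_comm y ((N : ℤ) • e κ) (e _), hper]) ((L : ℤ) • q) R hA
  -- monotonicity in the two nonnegative slots
  have hrat : (0 : ℝ) ≤ (1 + t) * ((((2 * ((L : ℤ) * ρ + 2 * L) + 1 : ℤ) : ℝ) ^ d) / (((2 * (R : ℤ) + 1 : ℤ) : ℝ) ^ d)) := by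
    have h2 : (0 : ℝ) ≤ (((2 * ((L : ℤ) * ρ + 2 * L) + 1 : ℤ) : ℝ)) := by exact_mod_cast (by linarith : (0 : ℤ) ≤ 2 * ((L : ℤ) * ρ + 2 * L) + 1)
    have h3 : (0 : ℝ) ≤ (((2 * (R : ℤ) + 1 : ℤ) : ℝ)) := by exact_mod_cast (by linarith : (0 : ℤ) ≤ 2 * (R : ℤ) + 1)
    have : (0 : ℝ) ≤ 1 + t := by linarith
    exact mul_nonneg this (div_nonneg (pow_nonneg h2 _) (pow_nonneg h3 _))
  have hgap : (0 : ℝ) ≤ (1 + 1 / t) * 13068 * ((((L : ℤ) * ρ + 2 * L : ℤ) : ℝ) + 1) ^ 2 := by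
    have : (0 : ℝ) ≤ 1 + 1 / t := by positivity
    positivity
  have key := add_le_add (mul_le_mul_of_nonneg_left hM hrat) (mul_le_mul_of_nonneg_left hG hgap)
  have hd0 : (0 : ℝ) ≤ 2 * d := by positivity
  exact h1.trans (mul_le_mul_of_nonneg_left (mul_le_mul_of_nonneg_left key hd0) hC)

end Priced

/-! ## §3 The Λ-part of ✓C summed over any finite centre set, given bounds uniform in the centre (any `d`) -/

section Sum

variable {d : ℕ} {𝔸 : Type*} [SeminormedAddCommGroup 𝔸]

/-- ★ **THE Λ-PART SUMMED, UNIFORMLY IN THE CENTRE**: if every reading box of radius `ρ' i` is bounded by `B i` whatever its centre (`i < n`), then the second summand of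
✓`Prop7CornerCombL1PropagationBoxes.sum_norm_linTower_le_boxes` (reading boxes `box (Lⁿ•z) (ρ' i)`, `box (Lⁿ•(z+e_κ)) (ρ' i)`, weights `Π_{m<i} w m ≥ 0`) over any finite centre
set `Zk` is at most `Σ_{i<n}(Π_{m<i} w m)·(2·d·#Zk·B i)`. [cite: Balaban1985Averaging, (42)–(43) pp.23–24, (125) p.36] -/
theorem sum_lambdaPart_le_of_uniform (L n : ℕ) (w : ℕ → ℝ) (hw : ∀ m, 0 ≤ w m) (s : Site d → Fin d → 𝔸) (Zk : Finset (Site d))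
    (ρ' : ℕ → ℤ) (B : ℕ → ℝ)
    (hB : ∀ i, i < n → ∀ q : Site d, ∑ x ∈ box q (ρ' i), ∑ μ : Fin d, ‖s x μ‖ ≤ B i) :
    ∑ i ∈ Finset.range n, (∏ m ∈ Finset.range i, w m) *
        ∑ z ∈ Zk, ∑ κ : Fin d,
          (∑ x ∈ box (((L : ℤ) ^ n) • z) (ρ' i), ∑ μ : Fin d, ‖s x μ‖ +
            ∑ x ∈ box (((L : ℤ) ^ n) • (z + e κ)) (ρ' i), ∑ μ : Fin d, ‖s x μ‖)
      ≤ ∑ i ∈ Finset.range n, (∏ m ∈ Finset.range i, w m) * (2 * d * Zk.card * B i) := by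
  refine Finset.sum_le_sum fun i hi => ?_
  have hi' : i < n := Finset.mem_range.mp hi
  refine mul_le_mul_of_nonneg_left ?_ (Finset.prod_nonneg fun m _ => hw m)
  calc ∑ z ∈ Zk, ∑ κ : Fin d,
          (∑ x ∈ box (((L : ℤ) ^ n) • z) (ρ' i), ∑ μ : Fin d, ‖s x μ‖ +
            ∑ x ∈ box (((L : ℤ) ^ n) • (z + e κ)) (ρ' i), ∑ μ : Fin d, ‖s x μ‖)
      ≤ ∑ _z ∈ Zk, ∑ _κ : Fin d, (B i + B i) :=
        Finset.sum_le_sum fun z _ => Finset.sum_le_sum fun κ _ => add_le_add (hB i hi' _) (hB i hi' _)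
    _ = 2 * d * Zk.card * B i := by
        rw [Finset.sum_const, Finset.sum_const, Finset.card_univ, Fintype.card_fin, nsmul_eq_mul, nsmul_eq_mul]
        ring

end Sum

/-! ## §4 The Λ-part of a tied source priced by period-cell currencies (`d = 3`) -/

section Main

variable {d : ℕ} {𝔸 : Type*} [SeminormedAddCommGroup 𝔸] {𝔅 : Type*} [SeminormedAddCommGroup 𝔅]

/-- ★★★ **THE Λ-PART OF THE `ℓ¹` PROPAGATION OF A TIED SOURCE, PRICED BY PERIOD-CELL CURRENCIES** (`d = 3`; §3 ∘ §2): `Ỹ` `N`-periodic, `s` tied to `Ỹ` with constant `C`,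
per-level reading radii `ρ' i ≥ 0`, big radii `R i` with `L·ρ' i + 2L ≤ R i` and counts `A i` with `2·R i + 1 ≤ A i·N` (`i < n`; the caller's choice), `t > 0`:
`Σ_{i<n}(Π_{m<i}w_m)·Σ_{z∈Zk}Σ_κ(Σ_{box (Lⁿ•z) (ρ' i)}Σ_μ‖s‖ + Σ_{box (Lⁿ•(z+e_κ)) (ρ' i)}Σ_μ‖s‖)`
`  ≤ Σ_{i<n}(Π_{m<i}w_m)·(2·d·#Zk·(C·(2d·((1+t)·((2(L·ρ' i+2L)+1)ᵈ∕(2·R i+1)ᵈ)·((A i)ᵈ·MASScell) + (1+t⁻¹)·13068·((L·ρ' i+2L)+1)²·((A i)ᵈ·NORMGAPcell)))))`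
with `MASScell = Σ_{y∈[0,N)ᵈ}Σ_ν‖Ỹ y ν‖²`, `NORMGAPcell = Σ_{y∈[0,N)ᵈ}Σ_νΣ_μ(‖Ỹ(y+e_μ) ν‖ − ‖Ỹ y ν‖)²` — the left side is ✓C's second summand at `Y := s` token for token
(up to its prefactor `d·L`).  «(O2) groundwork.» [cite: Balaban1985Averaging, (2) p.17, (42)–(43) pp.23–24, (124)–(126) p.36; Giaquinta1984, Ch. III §1 pp.64–72] -/
theorem sum_lambdaPart_tied_le_cell (hd : d = 3) (L : ℕ) (hL : 1 ≤ L) (s : Site d → Fin d → 𝔸) (Yt : Site d → Fin d → 𝔅)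
    {C : ℝ} (hC : 0 ≤ C)
    (hs : ∀ (y : Site d) (κ : Fin d), ‖s y κ‖ ≤ C * ∑ σ : Fin d → Fin L, ∑ ν : Fin d,
      (‖Yt ((L : ℤ) • y + boxVec L σ) ν‖ ^ 2 + ‖Yt ((L : ℤ) • y + (L : ℤ) • e κ + boxVec L σ) ν‖ ^ 2))
    (N : ℕ) [NeZero N] (hper : ∀ (x : Site d) (κ : Fin d), Yt (x + (N : ℤ) • e κ) = Yt x)
    (n : ℕ) (w : ℕ → ℝ) (hw : ∀ m, 0 ≤ w m) (Zk : Finset (Site d))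
    (ρ' : ℕ → ℤ) (hρ' : ∀ i, i < n → 0 ≤ ρ' i) (R A : ℕ → ℕ)
    (hR : ∀ i, i < n → (L : ℤ) * ρ' i + 2 * L ≤ (R i : ℤ)) (hA : ∀ i, i < n → 2 * R i + 1 ≤ A i * N)
    {t : ℝ} (ht : 0 < t) :
    ∑ i ∈ Finset.range n, (∏ m ∈ Finset.range i, w m) *
        ∑ z ∈ Zk, ∑ κ : Fin d,
          (∑ x ∈ box (((L : ℤ) ^ n) • z) (ρ' i), ∑ μ : Fin d, ‖s x μ‖ +
            ∑ x ∈ box (((L : ℤ) ^ n) • (z + e κ)) (ρ' i), ∑ μ : Fin d, ‖s x μ‖)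
      ≤ ∑ i ∈ Finset.range n, (∏ m ∈ Finset.range i, w m) * (2 * d * Zk.card *
          (C * (2 * d * ((1 + t) * ((((2 * ((L : ℤ) * ρ' i + 2 * L) + 1 : ℤ) : ℝ) ^ d) / (((2 * (R i : ℤ) + 1 : ℤ) : ℝ) ^ d)) *
                ((A i : ℝ) ^ d * ∑ y : Fin d → Fin N, ∑ ν : Fin d, ‖Yt (boxVec N y) ν‖ ^ 2) +
            (1 + 1 / t) * 13068 * ((((L : ℤ) * ρ' i + 2 * L : ℤ) : ℝ) + 1) ^ 2 *
                ((A i : ℝ) ^ d * ∑ y : Fin d → Fin N, ∑ ν : Fin d, ∑ μ : Fin d,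
                  (‖Yt (boxVec N y + e μ) ν‖ - ‖Yt (boxVec N y) ν‖) ^ 2))))) :=
  sum_lambdaPart_le_of_uniform L n w hw s Zk ρ' _ fun i hi q =>
    sum_norm_tied_box_le_cell hd L hL s Yt hC hs N (A i) hper q (hρ' i hi) (R i) (hR i hi) (hA i hi) ht

end Main

end Summit.QuantumFields.YangMills.Theorems.Prop7CornerCombH21ELambdaPricing

end
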